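import Summits.CriticalPhenomena.PercolationContinuityZ3.Theorems.PercShatteringRaceRaceLemma
import Summits.CriticalPhenomena.PercolationContinuityZ3.Theorems.PercShatteringRaceJumpUniquenessBoxLRO
import HarnessLib

/-!
# Crux `PercShatteringRace.NearLinearTwoClusterDecay` (stmt-CriticalPhenomena-5785) — what the route CONSUMES of `U`: the in-box LRO form

Helper file for the line `critical-orange-peeling` (seat c3, consumed-forms B); lands with
`--supports stmt-CriticalPhenomena-5785` (registered stubs `raceLemma_of_jumpBoxLRO`,
`jumpBoxLRO_of_jumpTwoClusterDecay`).

The route's deciding theorem `Theses.PercShatteringRace.closes hS hU hR` uses the two-cluster decay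
`U(b)` (aspect `R = ⌈n^{1+b}⌉₊`) only through the landed `Theorems.raceLemma_proof`, and that proof
uses `U(b)` only in the jump world `θ := θ(p_c) > 0` and only to produce the IN-BOX LONG-RANGE ORDER

  `∃ c > 0, ∀ᶠ n, ∀ y ∈ Λ_n, c ≤ P_{p_c}(0 ↔ y inside Λ_{⌈n^{1+b}⌉₊})`     (consumed form)

(with `c = θ²/2`).  This file certifies both halves of that factorisation:

* `raceLemma_of_jumpBoxLRO` (B1) — the race run from exactly the consumed form, for all real `a, b`
  with `0 ≤ b` and `(1 + b)(3 - a) < 3`: if `θ(p_c) ≠ 0` then `θ(p_c) > 0`, the consumed form gives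
  `c > 0` and `N` with `c ≤ P(0 ↔ y in Λ_R)` for `n ≥ N`, `y ∈ Λ_n`, `R = ⌈n^{1+b}⌉₊ ≥ n`; summing
  over `Λ_n ⊆ Λ_R` (`card_box`: `(2n+1)³` terms, the other terms `≥ 0`) the free-box susceptibility
  is `≥ (2n+1)³ c ≥ n³ c`, while `S(a)` bounds it by `C R^{3-a} ≤ K n^s` with `s < 3` (`s = 0`,
  `K = |C|` if `3 - a ≤ 0` since `R ≥ 1`; else `s = (1+b)(3-a)`, `K = |C| 2^{3-a}` since
  `R ≤ 2 n^{1+b}`); `n^{3-s} → ∞` is the contradiction.  The exponent arithmetic is that of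
  `raceLemma_proof` verbatim (it only uses `1 ≤ 1 + b`).
* `jumpBoxLRO_of_jumpTwoClusterDecay` (B2) — the jump form `0 < θ(p_c) → U(b)` gives the consumed
  form with `c = θ²/2`: by `theta_sq_le_real_openConnIn_add_real_twoClusters` (Harris–FKG,
  translation invariance, first exits; no uniqueness), `θ² ≤ P(0 ↔ y in Λ_R) + P(two clusters)` for
  `y ∈ Λ_n`, `R = ⌈n^{1+b}⌉₊ ≥ n`, and eventually `P(two clusters) < θ²/2`.

No new mathematics: `Measure.real` bookkeeping over the landed
`theta_sq_le_real_openConnIn_add_real_twoClusters`, `le_nat_ceil_rpow`, `card_box`, `box_mono`.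
-/

noncomputable section

namespace Summit.CriticalPhenomena.PercolationContinuityZ3.Theorems.NearLinearTwoClusterDecay.Consumed

open MeasureTheory Filter Topology
open Literature.Probability.LatticeModels Literature.Probability.Percolation

/-- **The race from the consumed form** (registered stub `raceLemma_of_jumpBoxLRO`): for real
`a, b` with `0 ≤ b` and `(1 + b)(3 - a) < 3`, the free-box power saving
`S(a) : Σ_{y ∈ Λ_R} P_{p_c}(0 ↔ y inside Λ_R) ≤ C R^{3-a}` (`R ≥ 1`) together with the in-box
long-range order in the jump world,
`0 < θ(p_c) → ∃ c > 0, ∀ᶠ n, ∀ y ∈ Λ_n, c ≤ P_{p_c}(0 ↔ y inside Λ_{⌈n^{1+b}⌉₊})`,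
give `θ(p_c) = 0` on `ℤ³` (`PercolationContinuityZ3`).  If `θ(p_c) > 0`: summing the lower bound
over `Λ_n ⊆ Λ_R`, `R = ⌈n^{1+b}⌉₊`, gives a free-box susceptibility `≥ (2n+1)³ c ≥ n³ c`, against
`S(a)`'s `C R^{3-a} ≤ K n^s` with `s < 3` (`s = 0` if `3 - a ≤ 0`, else `s = (1+b)(3-a)` using
`R ≤ 2 n^{1+b}`); `n^{3-s} → ∞`. [folklore] -/
theorem raceLemma_of_jumpBoxLRO : ∀ a b : ℝ, 0 ≤ b → (1 + b) * (3 - a) < 3 →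
    (∃ C : ℝ, ∀ R : ℕ, 1 ≤ R → ∑ y ∈ box 3 R,
      (bondPercolation (zdGraph 3) (criticalProbI 3)).real (openConnIn (↑(box 3 R) : Set (Site 3)) 0 y)
        ≤ C * (R : ℝ) ^ (3 - a)) →
    (0 < theta (zdGraph 3) 0 (criticalProbI 3) → ∃ c : ℝ, 0 < c ∧ ∀ᶠ n : ℕ in atTop, ∀ y ∈ box 3 n,
      c ≤ (bondPercolation (zdGraph 3) (criticalProbI 3)).real
        (openConnIn (↑(box 3 ⌈(n : ℝ) ^ (1 + b)⌉₊) : Set (Site 3)) 0 y)) →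
    _root_.PercolationContinuityZ3 := by
  intro a b hb hab hS hL
  show theta (zdGraph 3) (0 : Site 3) (criticalProbI 3) = 0
  by_contra hne
  have hθ : 0 < theta (zdGraph 3) (0 : Site 3) (criticalProbI 3) :=
    lt_of_le_of_ne measureReal_nonneg (Ne.symm hne)
  set μ := bondPercolation (zdGraph 3) (criticalProbI 3)
  obtain ⟨C, hC⟩ := hS
  -- the consumed form: `c > 0` and, eventually, `c ≤ P(0 ↔ y in Λ_R)` on `Λ_n`
  obtain ⟨c, hc, hev⟩ := hL hθ
  obtain ⟨N, hN⟩ := hev.exists_forall_of_atTop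
  -- the exponent race: `C R^{3-a} ≤ K n^s` with `s < 3`
  obtain ⟨K, s, hs3, hK⟩ : ∃ K s : ℝ, s < 3 ∧ ∀ n : ℕ, 1 ≤ n →
      C * ((⌈(n : ℝ) ^ (1 + b)⌉₊ : ℕ) : ℝ) ^ (3 - a) ≤ K * (n : ℝ) ^ s := by
    rcases le_or_gt (3 - a) 0 with ha | ha
    · refine ⟨|C|, 0, by norm_num, fun n hn => ?_⟩
      have hn1 : (1 : ℝ) ≤ n := by exact_mod_cast hn
      have hR1 : (1 : ℝ) ≤ ((⌈(n : ℝ) ^ (1 + b)⌉₊ : ℕ) : ℝ) := by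
        have h1 : (1 : ℝ) ≤ (n : ℝ) ^ (1 + b) := Real.one_le_rpow hn1 (by linarith)
        exact h1.trans (Nat.le_ceil _)
      have hle1 : ((⌈(n : ℝ) ^ (1 + b)⌉₊ : ℕ) : ℝ) ^ (3 - a) ≤ 1 :=
        Real.rpow_le_one_of_one_le_of_nonpos hR1 ha
      have hnn : 0 ≤ ((⌈(n : ℝ) ^ (1 + b)⌉₊ : ℕ) : ℝ) ^ (3 - a) :=
        Real.rpow_nonneg (by positivity) _
      rw [Real.rpow_zero, mul_one]
      calc C * ((⌈(n : ℝ) ^ (1 + b)⌉₊ : ℕ) : ℝ) ^ (3 - a)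
          ≤ |C| * ((⌈(n : ℝ) ^ (1 + b)⌉₊ : ℕ) : ℝ) ^ (3 - a) :=
            mul_le_mul_of_nonneg_right (le_abs_self C) hnn
        _ ≤ |C| * 1 := mul_le_mul_of_nonneg_left hle1 (abs_nonneg C)
        _ = |C| := mul_one _
    · refine ⟨|C| * (2 : ℝ) ^ (3 - a), (1 + b) * (3 - a), hab, fun n hn => ?_⟩
      have hn1 : (1 : ℝ) ≤ n := by exact_mod_cast hn
      have hn0 : (0 : ℝ) ≤ n := by positivity
      have hpow1 : (1 : ℝ) ≤ (n : ℝ) ^ (1 + b) := Real.one_le_rpow hn1 (by linarith)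
      have hpow0 : (0 : ℝ) ≤ (n : ℝ) ^ (1 + b) := zero_le_one.trans hpow1
      have hR2 : ((⌈(n : ℝ) ^ (1 + b)⌉₊ : ℕ) : ℝ) ≤ 2 * (n : ℝ) ^ (1 + b) := by
        have := Nat.ceil_lt_add_one hpow0
        linarith
      have hR0 : (0 : ℝ) ≤ ((⌈(n : ℝ) ^ (1 + b)⌉₊ : ℕ) : ℝ) := by positivity
      have hRpow : ((⌈(n : ℝ) ^ (1 + b)⌉₊ : ℕ) : ℝ) ^ (3 - a) ≤
          (2 : ℝ) ^ (3 - a) * (n : ℝ) ^ ((1 + b) * (3 - a)) := by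
        calc ((⌈(n : ℝ) ^ (1 + b)⌉₊ : ℕ) : ℝ) ^ (3 - a)
            ≤ (2 * (n : ℝ) ^ (1 + b)) ^ (3 - a) := Real.rpow_le_rpow hR0 hR2 ha.le
          _ = (2 : ℝ) ^ (3 - a) * ((n : ℝ) ^ (1 + b)) ^ (3 - a) :=
              Real.mul_rpow (by norm_num) hpow0
          _ = (2 : ℝ) ^ (3 - a) * (n : ℝ) ^ ((1 + b) * (3 - a)) := by
              rw [← Real.rpow_mul hn0]
      have hnn : 0 ≤ ((⌈(n : ℝ) ^ (1 + b)⌉₊ : ℕ) : ℝ) ^ (3 - a) := Real.rpow_nonneg hR0 _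
      calc C * ((⌈(n : ℝ) ^ (1 + b)⌉₊ : ℕ) : ℝ) ^ (3 - a)
          ≤ |C| * ((⌈(n : ℝ) ^ (1 + b)⌉₊ : ℕ) : ℝ) ^ (3 - a) :=
            mul_le_mul_of_nonneg_right (le_abs_self C) hnn
        _ ≤ |C| * ((2 : ℝ) ^ (3 - a) * (n : ℝ) ^ ((1 + b) * (3 - a))) :=
            mul_le_mul_of_nonneg_left hRpow (abs_nonneg C)
        _ = |C| * (2 : ℝ) ^ (3 - a) * (n : ℝ) ^ ((1 + b) * (3 - a)) := by ring
  -- for large `n`, the free-box susceptibility at scale `R = ⌈n^{1+b}⌉₊` is `≥ (2n+1)³ c`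
  have hmain : ∀ n : ℕ, N ≤ n → 1 ≤ n →
      (((2 * n + 1) ^ 3 : ℕ) : ℝ) * c ≤ K * (n : ℝ) ^ s := by
    intro n hNn hn
    set R : ℕ := ⌈(n : ℝ) ^ (1 + b)⌉₊
    have hnR : n ≤ R := le_nat_ceil_rpow (by linarith) n
    have hR1 : 1 ≤ R := hn.trans hnR
    have hsum : (((2 * n + 1) ^ 3 : ℕ) : ℝ) * c ≤
        ∑ y ∈ box 3 R, μ.real (openConnIn (↑(box 3 R) : Set (Site 3)) 0 y) := by
      calc (((2 * n + 1) ^ 3 : ℕ) : ℝ) * c = ∑ _y ∈ box 3 n, c := by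
            rw [Finset.sum_const, card_box, nsmul_eq_mul]
        _ ≤ ∑ y ∈ box 3 n, μ.real (openConnIn (↑(box 3 R) : Set (Site 3)) 0 y) :=
            Finset.sum_le_sum (hN n hNn)
        _ ≤ ∑ y ∈ box 3 R, μ.real (openConnIn (↑(box 3 R) : Set (Site 3)) 0 y) :=
            Finset.sum_le_sum_of_subset_of_nonneg (box_mono 3 hnR)
              fun _ _ _ => measureReal_nonneg
    exact hsum.trans ((hC R hR1).trans (hK n hn))
  -- contradiction: `n³ c ≤ (2n+1)³ c ≤ K n^s` with `s < 3`
  have htend : Tendsto (fun n : ℕ => ((n : ℝ)) ^ (3 - s)) atTop atTop :=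
    (tendsto_rpow_atTop (by linarith : (0 : ℝ) < 3 - s)).comp tendsto_natCast_atTop_atTop
  obtain ⟨n, hn⟩ := ((htend.eventually_gt_atTop (K / c)).and
    ((eventually_ge_atTop N).and (eventually_ge_atTop 1))).exists
  obtain ⟨hbig, hNn, hn1⟩ := hn
  have hnpos : (0 : ℝ) < n := by exact_mod_cast hn1
  have hns : 0 < (n : ℝ) ^ s := Real.rpow_pos_of_pos hnpos s
  have h3 : (n : ℝ) ^ (3 : ℝ) = (n : ℝ) ^ (3 - s) * (n : ℝ) ^ s := by
    rw [← Real.rpow_add hnpos, sub_add_cancel]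
  have h3' : (n : ℝ) ^ (3 : ℝ) = ((n ^ 3 : ℕ) : ℝ) := by
    rw [show (3 : ℝ) = ((3 : ℕ) : ℝ) by norm_num, Real.rpow_natCast]
    push_cast
    rfl
  have hcube : ((n ^ 3 : ℕ) : ℝ) ≤ (((2 * n + 1) ^ 3 : ℕ) : ℝ) := by
    exact_mod_cast Nat.pow_le_pow_left (by omega : n ≤ 2 * n + 1) 3
  have hK' : K < c * (n : ℝ) ^ (3 - s) := by
    have := (div_lt_iff₀ hc).1 hbig
    linarith
  have hlt : K * (n : ℝ) ^ s < (((2 * n + 1) ^ 3 : ℕ) : ℝ) * c :=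
    calc K * (n : ℝ) ^ s < (c * (n : ℝ) ^ (3 - s)) * (n : ℝ) ^ s :=
          mul_lt_mul_of_pos_right hK' hns
      _ = ((n ^ 3 : ℕ) : ℝ) * c := by rw [← h3', h3]; ring
      _ ≤ (((2 * n + 1) ^ 3 : ℕ) : ℝ) * c := mul_le_mul_of_nonneg_right hcube hc.le
  exact absurd (hmain n hNn hn1) (not_le.2 hlt)

/-- **The jump form of `U(b)` gives the consumed form** (registered stub
`jumpBoxLRO_of_jumpTwoClusterDecay`): for real `b ≥ 0`, if in the jump world `θ := θ(p_c) > 0` the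
two-distinct-crossing-clusters event of `(Λ_n, Λ_{⌈n^{1+b}⌉₊})` has probability `→ 0` at `p_c(ℤ³)`,
then in the jump world `∃ c > 0, ∀ᶠ n, ∀ y ∈ Λ_n, c ≤ P_{p_c}(0 ↔ y inside Λ_{⌈n^{1+b}⌉₊})`, with
`c = θ²/2`: `θ² ≤ P(0 ↔ y in Λ_R) + P(two clusters)` for `y ∈ Λ_n`, `R = ⌈n^{1+b}⌉₊ ≥ n`
(`theta_sq_le_real_openConnIn_add_real_twoClusters`: Harris–FKG, translation invariance, first
exits; no uniqueness of the infinite cluster), and eventually `P(two clusters) < θ²/2`. [folklore] -/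
theorem jumpBoxLRO_of_jumpTwoClusterDecay : ∀ b : ℝ, 0 ≤ b →
    (0 < theta (zdGraph 3) 0 (criticalProbI 3) →
      Tendsto (fun n : ℕ => (bondPercolation (zdGraph 3) (criticalProbI 3)).real
        {ω | ∃ x ∈ box 3 n, ∃ x' ∈ box 3 n, ∃ y ∈ innerBoundary (zdGraph 3) (box 3 ⌈(n : ℝ) ^ (1 + b)⌉₊),
          ∃ y' ∈ innerBoundary (zdGraph 3) (box 3 ⌈(n : ℝ) ^ (1 + b)⌉₊),
            ω ∈ openConnIn (↑(box 3 ⌈(n : ℝ) ^ (1 + b)⌉₊) : Set (Site 3)) x y ∧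
            ω ∈ openConnIn (↑(box 3 ⌈(n : ℝ) ^ (1 + b)⌉₊) : Set (Site 3)) x' y' ∧
            ω ∉ openConnIn (↑(box 3 ⌈(n : ℝ) ^ (1 + b)⌉₊) : Set (Site 3)) x x'}) atTop (𝓝 0)) →
    (0 < theta (zdGraph 3) 0 (criticalProbI 3) → ∃ c : ℝ, 0 < c ∧ ∀ᶠ n : ℕ in atTop, ∀ y ∈ box 3 n,
      c ≤ (bondPercolation (zdGraph 3) (criticalProbI 3)).real
        (openConnIn (↑(box 3 ⌈(n : ℝ) ^ (1 + b)⌉₊) : Set (Site 3)) 0 y)) := by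
  intro b hb hUj hθ
  refine ⟨theta (zdGraph 3) 0 (criticalProbI 3) ^ 2 / 2, by positivity, ?_⟩
  filter_upwards [(hUj hθ).eventually (gt_mem_nhds (half_pos (pow_pos hθ 2)))] with n hn y hy
  have h1 := theta_sq_le_real_openConnIn_add_real_twoClusters (criticalProbI 3)
    (le_nat_ceil_rpow (by linarith : (1 : ℝ) ≤ 1 + b) n) (zero_mem_box 3 n) hy
  linarith

end Summit.CriticalPhenomena.PercolationContinuityZ3.Theorems.NearLinearTwoClusterDecay.Consumed
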